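import Mathlib
import Literature.Combinatorics.Optimization.BinaryCspLpHardnessFromMaxCut
import Literature.Combinatorics.Optimization.KMRLpLowerBoundsUnconditional
import HarnessLib

/-!
# LP lower bounds for MAX-CUT and the binary CSPs with the PRINTED constants — unconditional

Sink module (composition only; theorems, 0 definitions, 0 named facts).  Since littype-FN2-1 g20 the
Charikar–Makarychev–Makarychev polynomial-round Sherali–Adams gap for MAX-CUT is a theorem of the
tree (`CharikarMakarychevMakarychev2009_maxCutSA_holds`, `MaxCutSheraliAdamsGap.lean`), and KMR
Theorem 1.10 is one since g16 (`KothariMekaRaghavendra2017_thm110_holds`).  This file records what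
the tree's reductions then give WITHOUT hypotheses:

* **Polynomial regime** (Chan–Lee–Raghavendra–Steurer Thm 3.1, `ChanEtAl2016_thm31_holds`): the
  conditional theorems `maxCut_poly_lp_of_CMM`, `maxCut_poly_lpGap_of_CMM`
  (`PolySizeLpIntegralityGaps.lean`) and `binaryCsp_poly_lp_of_neq_of_CMM`,
  `binaryCsp_poly_lp_of_clauses_of_CMM`, `maxTwoSat_poly_lp_of_CMM`,
  `binaryCsp_poly_lp_of_dicut_of_CMM`, `maxDicut_poly_lp_of_CMM`, `maxTwoConjSat_poly_lp_of_CMM`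
  (`BinaryCspLpHardnessFromMaxCut.lean`) fed with the CMM theorem: `maxCut_poly_lp_cmm` (MAX-CUT,
  `(1 − ε, 1/2 + ε)`), `maxCut_poly_lpGap_cmm` ("every polynomial-size LP for Max Cut has integrality
  gap 1/2", [ChanEtAl2016, §1]), `binaryCsp_poly_lp_of_neq_cmm` (Max-2-CSP ∋ `≠`, `(1 − ε, 1/2 + ε)`,
  [BraunPokuttaZink2015, Cor. 6.4]), `binaryCsp_poly_lp_of_clauses_cmm` / `maxTwoSat_poly_lp_cmm`
  (Max-2-SAT, `(1 − ε, 3/4 + ε)`, Cor. 6.6), `binaryCsp_poly_lp_of_dicut_cmm` / `maxDicut_poly_lp_cmm` /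
  `maxTwoConjSat_poly_lp_cmm` (MaxDICUT / Max-2-CONJSAT, `(1/2 − ε, 1/4 + ε)`, Cor. 6.8 / 6.4) — no LP
  relaxation (Kothari–Meka–Raghavendra Def. 1.1) of size `≤ n^{d/2}` achieves these, every `d ≥ 2`, all
  large `n`.
* **Weakly-exponential regime** (Kothari–Meka–Raghavendra Thm 1.2 in the form its proof delivers,
  `KothariMekaRaghavendra2017_thm12_proved`): the predicate-independent transfer
  `KothariMekaRaghavendra2017_lp_of_polyRoundSAGap` — a POLYNOMIAL-round Sherali–Adams gap (for every
  `ε > 0` some `γ > 0` with degree-`⌊n^γ⌋` Sherali–Adams failing `(1 − ε, s₀ + ε)` for all large `n`,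
  the shape of KMR Thm 1.3) gives, for every `ε > 0`, `c₃ > 0` and `N₀` such that no LP relaxation of
  size `< 2^{N^{c₃}}` achieves `(1 − ε, s₀ + ε)` on `N ≥ N₀` variables (the `(c,s)` form; proof = the
  printed proof of Cor. 1.5, p. 21, run once for arbitrary `𝒫`), and its integrality-gap reading
  `KothariMekaRaghavendra2017_lpGap_of_polyRoundSAGap` (gap `< 1/s₀ − ε` impossible; `0 < s₀ < 1`).
  Instances: `KothariMekaRaghavendra2017_maxCut_lp` (MAX-CUT: no LP relaxation of size `< 2^{N^{c₃}}`
  achieves `(1 − ε, 1/2 + ε)` — the `(c,s)` form behind the MAX-CUT clause of Cor. 1.5, whose gap form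
  `KothariMekaRaghavendra2017_cor15_maxCut_holds` is already in the tree), and, through the
  Braun–Pokutta–Zink reductions `LPRelaxation.maxCut_of_incl/_sat/_dicut` (Prop. 4.2: `+2`
  inequalities, same number of variables): `binaryCsp_subexp_lp_of_neq` (`(1 − ε, 1/2 + ε)`),
  `binaryCsp_subexp_lp_of_clauses` / `maxTwoSat_subexp_lp` (`(1 − ε, 3/4 + ε)`),
  `binaryCsp_subexp_lp_of_dicut` / `maxDicut_subexp_lp` / `maxTwoConjSat_subexp_lp`
  (`(1/2 − ε, 1/4 + ε)`), and the gap forms `binaryCsp_subexp_lpGap_of_neq` (`2 − ε`),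
  `maxTwoSat_subexp_lpGap` (`4/3 − ε`), `maxDicut_subexp_lpGap` (`2 − ε`) — all below size `2^{N^{c}}`.

Recorded deviations (bookkeeping, not repairs).  (i) [BraunPokuttaZink2015] prints the LP clauses of
Cor. 6.4/6.6/6.8 as `fc ≥ n^{Ω(log n/log log n)}` (their MaxCUT input being [CLRS13] Thm 3.2 × [CMM09]);
the `2^{N^{c}}` regime here is the SAME printed reductions composed with the Kothari–Meka–Raghavendra
MAX-CUT bound instead — a consequence the tree proves, not a statement printed in [BraunPokuttaZink2015]
(KMR p. 4 announce "similar bounds" only for pairwise-independent predicates).  (ii) The currency is KMR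
LP relaxations (`LPRelaxation k n 𝒫 R`, `Achieves c s`, `GapLT ρ`), as in the two source files.
(iii) Constants: `c₃ = γ(ε/2)/(2H)` for the transfer, halved once more by the `+2` padding of the
reductions (`R < 2^{N^{c₃/2}} ⇒ R + 2 < 2^{N^{c₃}}` for `N^{c₃/2} ≥ 2`, `two_rpow_pad`).

## References
* P. K. Kothari, R. Meka, P. Raghavendra, *Approximating rectangles by juntas and weakly-exponential
  lower bounds for LP relaxations of CSPs*, STOC 2017 / SIAM J. Comput. 51 (2022), arXiv:1610.02704 —
  Thm 1.2, Thm 1.3, Cor. 1.5 (p. 3–4), proof of Cor. 1.5 (§7, p. 21) [KothariMekaRaghavendra2017]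
  (held text `paper:arxiv-1610.02704`, p. 4 re-read by this seat).
* M. Charikar, K. Makarychev, Y. Makarychev, *Integrality gaps for Sherali–Adams relaxations*, STOC
  2009, Thm 5.3 [CharikarMakarychevMakarychev2009].
* S. O. Chan, J. R. Lee, P. Raghavendra, D. Steurer, *Approximate constraint satisfaction requires
  large LP relaxations*, FOCS 2013 / J. ACM 63 (2016), §1 and Thm 3.1 [ChanEtAl2016].
* G. Braun, S. Pokutta, D. Zink, *Inapproximability of combinatorial problems via small LPs and SDPs*,
  STOC 2015, Prop. 4.2, Cor. 6.4, 6.6, 6.8 [BraunPokuttaZink2015].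
-/

noncomputable section

open Finset

namespace Literature.Combinatorics.Optimization

/-! ### Polynomial regime: the printed constants, unconditional -/

section Polynomial

/-- **Max Cut: polynomial-size LPs do not `(1 − ε, 1/2 + ε)`-approximate — UNCONDITIONAL.**  For every
`ε > 0` and `d ≥ 2`, for all large `n`, no LP relaxation of Max Cut on `n` vertices of size `≤ n^{d/2}`
achieves a `(1 − ε, 1/2 + ε)`-approximation (`maxCut_poly_lp_of_CMM` fed with
`CharikarMakarychevMakarychev2009_maxCutSA_holds`).
[cite: ChanEtAl2016, §1 (arXiv v3 p. 3) and Thm 3.1 (p. 9: "known Sherali–Adams gaps for Max Cut [CMM09]")]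
[cite: CharikarMakarychevMakarychev2009, Thm 5.3] -/
theorem maxCut_poly_lp_cmm {ε : ℝ} (hε : 0 < ε) {d : ℕ} (hd : 2 ≤ d) :
    ∃ n₀ : ℕ, ∀ n : ℕ, n₀ ≤ n → ∀ R : ℕ, (R : ℝ) ≤ (n : ℝ) ^ ((d : ℝ) / 2) →
      ∀ L : LPRelaxation 2 n maxCutPreds R, ¬ L.Achieves (1 - ε) (1 / 2 + ε) :=
  maxCut_poly_lp_of_CMM CharikarMakarychevMakarychev2009_maxCutSA_holds hε hd

/-- **"Every polynomial-sized LP for Max Cut has an integrality gap of 1/2" — UNCONDITIONAL:** for every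
`ε > 0` and `d ≥ 2`, for all large `n`, no LP relaxation of Max Cut on `n` vertices of size `≤ n^{d/2}`
has integrality gap `< 2 − ε`.
[cite: ChanEtAl2016, §1 (arXiv v3 p. 3: "answering a question from [BraunFPS12]") and Thm 3.1 (p. 9)]
[cite: CharikarMakarychevMakarychev2009, Thm 5.3] -/
theorem maxCut_poly_lpGap_cmm {ε : ℝ} (hε : 0 < ε) {d : ℕ} (hd : 2 ≤ d) :
    ∃ n₀ : ℕ, ∀ n : ℕ, n₀ ≤ n → ∀ R : ℕ, (R : ℝ) ≤ (n : ℝ) ^ ((d : ℝ) / 2) →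
      ∀ L : LPRelaxation 2 n maxCutPreds R, ¬ L.GapLT (2 - ε) :=
  maxCut_poly_lpGap_of_CMM CharikarMakarychevMakarychev2009_maxCutSA_holds hε hd

/-- **Cor. 6.4 (Max-2-CSP), LP clause, printed constants, polynomial regime — UNCONDITIONAL:** for every
binary predicate family containing `≠`, every `ε > 0` and `d ≥ 2`, for all large `n` no LP relaxation of
size `≤ n^{d/2}` achieves `(1 − ε, 1/2 + ε)`.
[cite: BraunPokuttaZink2015, Cor. 6.4 (LP clause) with Prop. 4.2] [cite: CharikarMakarychevMakarychev2009, Thm 5.3] -/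
theorem binaryCsp_poly_lp_of_neq_cmm {P₂ : Set ((Fin 2 → Bool) → Bool)} (hP : neqPred ∈ P₂) {ε : ℝ}
    (hε : 0 < ε) {d : ℕ} (hd : 2 ≤ d) :
    ∃ n₀ : ℕ, ∀ n : ℕ, n₀ ≤ n → ∀ R : ℕ, (R : ℝ) ≤ (n : ℝ) ^ ((d : ℝ) / 2) →
      ∀ L : LPRelaxation 2 n P₂ R, ¬ L.Achieves (1 - ε) (1 / 2 + ε) :=
  binaryCsp_poly_lp_of_neq_of_CMM CharikarMakarychevMakarychev2009_maxCutSA_holds hP hε hd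

/-- **Cor. 6.6 (Max-2-SAT), LP clause, printed constants `(1 − ε, 3/4 + ε)`, polynomial regime —
UNCONDITIONAL**, for any binary family containing the clauses `y_0 ∨ y_1`, `ȳ_0 ∨ ȳ_1`.
[cite: BraunPokuttaZink2015, Cor. 6.6 (LP clause) with Prop. 4.2] [cite: CharikarMakarychevMakarychev2009, Thm 5.3] -/
theorem binaryCsp_poly_lp_of_clauses_cmm {P₂ : Set ((Fin 2 → Bool) → Bool)}
    (h0 : clausePred (fun _ => false) ∈ P₂) (h1 : clausePred (fun _ => true) ∈ P₂) {ε : ℝ} (hε : 0 < ε)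
    {d : ℕ} (hd : 2 ≤ d) :
    ∃ n₀ : ℕ, ∀ n : ℕ, n₀ ≤ n → ∀ R : ℕ, (R : ℝ) ≤ (n : ℝ) ^ ((d : ℝ) / 2) →
      ∀ L : LPRelaxation 2 n P₂ R, ¬ L.Achieves (1 - ε) (3 / 4 + ε) :=
  binaryCsp_poly_lp_of_clauses_of_CMM CharikarMakarychevMakarychev2009_maxCutSA_holds h0 h1 hε hd

/-- **Max-2-SAT with the printed constants `(1 − ε, 3/4 + ε)`, polynomial regime — UNCONDITIONAL.**
[cite: BraunPokuttaZink2015, Cor. 6.6 (LP clause)] [cite: CharikarMakarychevMakarychev2009, Thm 5.3] -/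
theorem maxTwoSat_poly_lp_cmm {ε : ℝ} (hε : 0 < ε) {d : ℕ} (hd : 2 ≤ d) :
    ∃ n₀ : ℕ, ∀ n : ℕ, n₀ ≤ n → ∀ R : ℕ, (R : ℝ) ≤ (n : ℝ) ^ ((d : ℝ) / 2) →
      ∀ L : LPRelaxation 2 n (maxKSatPreds 2) R, ¬ L.Achieves (1 - ε) (3 / 4 + ε) :=
  maxTwoSat_poly_lp_of_CMM CharikarMakarychevMakarychev2009_maxCutSA_holds hε hd

/-- **Cor. 6.8 (MaxDICUT) / Cor. 6.4 (Max-2-CONJSAT), LP clauses, printed constants `(1/2 − ε, 1/4 + ε)`,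
polynomial regime — UNCONDITIONAL**, for any binary family containing `¬y_0 ∧ y_1`.
[cite: BraunPokuttaZink2015, Cor. 6.8 and Cor. 6.4 (LP clauses) with Prop. 4.2] [cite: CharikarMakarychevMakarychev2009, Thm 5.3] -/
theorem binaryCsp_poly_lp_of_dicut_cmm {P₂ : Set ((Fin 2 → Bool) → Bool)} (hP : dicutPred ∈ P₂) {ε : ℝ}
    (hε : 0 < ε) {d : ℕ} (hd : 2 ≤ d) :
    ∃ n₀ : ℕ, ∀ n : ℕ, n₀ ≤ n → ∀ R : ℕ, (R : ℝ) ≤ (n : ℝ) ^ ((d : ℝ) / 2) →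
      ∀ L : LPRelaxation 2 n P₂ R, ¬ L.Achieves (1 / 2 - ε) (1 / 4 + ε) :=
  binaryCsp_poly_lp_of_dicut_of_CMM CharikarMakarychevMakarychev2009_maxCutSA_holds hP hε hd

/-- **MaxDICUT with the printed constants `(1/2 − ε, 1/4 + ε)`, polynomial regime — UNCONDITIONAL.**
[cite: BraunPokuttaZink2015, Cor. 6.8 (LP clause)] [cite: CharikarMakarychevMakarychev2009, Thm 5.3] -/
theorem maxDicut_poly_lp_cmm {ε : ℝ} (hε : 0 < ε) {d : ℕ} (hd : 2 ≤ d) :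
    ∃ n₀ : ℕ, ∀ n : ℕ, n₀ ≤ n → ∀ R : ℕ, (R : ℝ) ≤ (n : ℝ) ^ ((d : ℝ) / 2) →
      ∀ L : LPRelaxation 2 n dicutPreds R, ¬ L.Achieves (1 / 2 - ε) (1 / 4 + ε) :=
  maxDicut_poly_lp_of_CMM CharikarMakarychevMakarychev2009_maxCutSA_holds hε hd

/-- **Max-2-CONJSAT with the printed constants `(1/2 − ε, 1/4 + ε)`, polynomial regime — UNCONDITIONAL.**
[cite: BraunPokuttaZink2015, Cor. 6.4 (Max-2-CONJSAT, LP clause)] [cite: CharikarMakarychevMakarychev2009, Thm 5.3] -/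
theorem maxTwoConjSat_poly_lp_cmm {ε : ℝ} (hε : 0 < ε) {d : ℕ} (hd : 2 ≤ d) :
    ∃ n₀ : ℕ, ∀ n : ℕ, n₀ ≤ n → ∀ R : ℕ, (R : ℝ) ≤ (n : ℝ) ^ ((d : ℝ) / 2) →
      ∀ L : LPRelaxation 2 n (literalClosure andTwo) R, ¬ L.Achieves (1 / 2 - ε) (1 / 4 + ε) :=
  maxTwoConjSat_poly_lp_of_CMM CharikarMakarychevMakarychev2009_maxCutSA_holds hε hd

end Polynomial

/-! ### Weakly-exponential regime: polynomial-round Sherali–Adams gaps lift to size `2^{N^{c}}` -/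

section WeaklyExponential

/-- **KMR Thm 1.2 × a polynomial-round Sherali–Adams gap (the shape of Thm 1.3), `(c,s)` form, for an
arbitrary Max-CSP — PROVED.**  Let `s₀ < 1` and suppose that for every `ε > 0` there are `γ > 0`, `n₀`
such that for all `n ≥ n₀` the degree-`⌊n^γ⌋` Sherali–Adams relaxation fails to
`(1 − ε, s₀ + ε)`-approximate Max-`𝒫_n`.  Then for every `ε > 0` there are `c₃ > 0`, `N₀` with: for all
`N ≥ N₀`, no LP relaxation of Max-`𝒫_N` of size `R < 2^{N^{c₃}}` achieves a `(1 − ε, s₀ + ε)`-approximation.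
Proof as printed for Cor. 1.5 (p. 21), in `(c,s)` form: WLOG `ε ≤ (1 − s₀)/4`; the gap at `ε/2` gives
`γ`; `(c, s) = (1 − ε/2, s₀ + ε/2)`, `f(m) = ⌊m^γ⌋`; Thm 1.2 (proved form, conclusion `(c − 1/m, s)`) on
`m^H` variables, `m = ⌊N^{1/H}⌋ ≥ 2/ε`; restriction of the relaxation, `1 − ε ≤ c − 1/m`, `s ≤ s₀ + ε`;
`2^{N^{c₃}} ≤ m^{h f(m)}` for `c₃ = γ/(2H)` and `N` large.
[cite: KothariMekaRaghavendra2017, Thm 1.2, Thm 1.3 (p. 3–4) and the proof of Cor. 1.5 (§7, p. 21)] -/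
theorem KothariMekaRaghavendra2017_lp_of_polyRoundSAGap {k : ℕ} (P : Set ((Fin k → Bool) → Bool))
    {s₀ : ℝ} (hs₁ : s₀ < 1)
    (hSAgap : ∀ ε : ℝ, 0 < ε → ∃ γ : ℝ, 0 < γ ∧ ∃ n₀ : ℕ, ∀ n : ℕ, n₀ ≤ n →
      ¬ SAAchieves (n := n) P ⌊(n : ℝ) ^ γ⌋₊ (1 - ε) (s₀ + ε))
    {ε : ℝ} (hε : 0 < ε) :
    ∃ c₃ : ℝ, 0 < c₃ ∧ ∃ N₀ : ℕ, ∀ N : ℕ, N₀ ≤ N →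
      ∀ R : ℕ, (R : ℝ) < (2 : ℝ) ^ ((N : ℝ) ^ c₃) →
        ∀ L : LPRelaxation k N P R, ¬ L.Achieves (1 - ε) (s₀ + ε) := by
  obtain ⟨h, H, n₀, hh, hhH, T12⟩ := KothariMekaRaghavendra2017_thm12_proved
  have hH0 : H ≠ 0 := by
    rintro rfl
    simp at hhH
    linarith
  have hHpos : (0 : ℝ) < H := by exact_mod_cast Nat.pos_of_ne_zero hH0
  -- WLOG `ε ≤ (1 − s₀)/4`
  suffices main : ∀ ε : ℝ, 0 < ε → ε ≤ (1 - s₀) / 4 → ∃ c₃ : ℝ, 0 < c₃ ∧ ∃ N₀ : ℕ, ∀ N : ℕ, N₀ ≤ N →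
      ∀ R : ℕ, (R : ℝ) < (2 : ℝ) ^ ((N : ℝ) ^ c₃) →
        ∀ L : LPRelaxation k N P R, ¬ L.Achieves (1 - ε) (s₀ + ε) by
    obtain ⟨c₃, hc₃, N₀, hN₀⟩ :=
      main (min ε ((1 - s₀) / 4)) (lt_min hε (by linarith)) (min_le_right _ _)
    refine ⟨c₃, hc₃, N₀, fun N hN R hR L hL => hN₀ N hN R hR L ?_⟩
    intro I hI
    exact (hL I (hI.mono (by linarith [min_le_left ε ((1 - s₀) / 4)]))).mono
      (by linarith [min_le_left ε ((1 - s₀) / 4)])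
  intro ε hε hε1
  -- the Sherali–Adams gap at `ε/2`
  obtain ⟨γ, hγ, n₁, HSA⟩ := hSAgap (ε / 2) (by positivity)
  -- parameters
  set s : ℝ := s₀ + ε / 2 with hsdef
  set c : ℝ := 1 - ε / 2 with hcdef
  have hc1 : c ≤ 1 := by rw [hcdef]; linarith
  have hcs : (1 - s₀) / 2 < c - s := by rw [hcdef, hsdef]; linarith
  set f : ℕ → ℕ := fun m => ⌊(m : ℝ) ^ γ⌋₊ with hfdef
  set c₃ : ℝ := γ / (2 * H) with hc₃def
  have hc₃ : 0 < c₃ := by rw [hc₃def]; positivity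
  -- the constant `K₀ = 2^{1+γ}/h` and the thresholds
  set K₀ : ℝ := 2 * (2 : ℝ) ^ γ / h with hK₀def
  have hK₀ : 0 < K₀ := by rw [hK₀def]; positivity
  set nthr : ℕ := n₀ + n₁ + 10 + ⌈(((16 * k + 2 : ℕ) : ℝ)) ^ (1 / γ)⌉₊ + ⌈2 / ε⌉₊ + ⌈2 / (1 - s₀)⌉₊
    with hnthr
  set N₀ : ℕ := max ((nthr + 1) ^ H) ⌈K₀ ^ (2 * (H : ℝ) / γ)⌉₊ with hN₀def
  refine ⟨c₃, hc₃, N₀, fun N hN R hR L hL => ?_⟩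
  have hN1 : (nthr + 1) ^ H ≤ N := le_trans (le_max_left _ _) hN
  have hN2 : ⌈K₀ ^ (2 * (H : ℝ) / γ)⌉₊ ≤ N := le_trans (le_max_right _ _) hN
  have hNR0 : (0 : ℝ) ≤ N := Nat.cast_nonneg N
  -- `y = N^{1/H}`, `m = ⌊y⌋`
  set y : ℝ := (N : ℝ) ^ (1 / (H : ℝ)) with hydef
  have hy0 : 0 ≤ y := Real.rpow_nonneg hNR0 _
  have hyH : y ^ H = N := by
    rw [hydef, one_div]; exact Real.rpow_inv_natCast_pow hNR0 hH0
  have hythr : (nthr : ℝ) + 1 ≤ y := by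
    have h1 : (((nthr + 1) ^ H : ℕ) : ℝ) ≤ N := by exact_mod_cast hN1
    have h2 : ((((nthr + 1) ^ H : ℕ) : ℝ)) ^ (1 / (H : ℝ)) ≤ y :=
      Real.rpow_le_rpow (Nat.cast_nonneg _) h1 (by positivity)
    have h3 : ((((nthr + 1) ^ H : ℕ) : ℝ)) ^ (1 / (H : ℝ)) = nthr + 1 := by
      push_cast
      rw [one_div]
      exact Real.pow_rpow_inv_natCast (by positivity) hH0
    linarith
  set m : ℕ := ⌊y⌋₊ with hmdef
  have hmy : (m : ℝ) ≤ y := Nat.floor_le hy0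
  have hmy' : y - 1 ≤ (m : ℝ) := (Nat.sub_one_lt_floor y).le
  have hmthr : nthr ≤ m := by
    have : (nthr : ℝ) ≤ m := by linarith
    exact_mod_cast this
  have hnthr10 : (10 : ℝ) ≤ nthr := by exact_mod_cast (by omega : 10 ≤ nthr)
  have hmy2 : y / 2 ≤ (m : ℝ) := by linarith
  have hmH : m ^ H ≤ N := by
    have h1 : ((m : ℝ)) ^ H ≤ y ^ H := pow_le_pow_left₀ (Nat.cast_nonneg m) hmy H
    rw [hyH] at h1
    exact_mod_cast h1
  -- consequences of `m ≥ nthr`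
  have hmn₀ : n₀ ≤ m := by omega
  have hmn₁ : n₁ ≤ m := by omega
  have hm10 : 10 ≤ m := by omega
  have hmR : (10 : ℝ) ≤ m := by exact_mod_cast hm10
  have hm0 : (0 : ℝ) < m := by linarith
  have hm16k : (((16 * k + 2 : ℕ) : ℝ)) ≤ (m : ℝ) ^ γ := by
    have h1 : ⌈(((16 * k + 2 : ℕ) : ℝ)) ^ (1 / γ)⌉₊ ≤ m := by omega
    have h2 : (((16 * k + 2 : ℕ) : ℝ)) ^ (1 / γ) ≤ m := (Nat.le_ceil _).trans (by exact_mod_cast h1)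
    calc (((16 * k + 2 : ℕ) : ℝ)) = ((((16 * k + 2 : ℕ) : ℝ)) ^ (1 / γ)) ^ γ := by
          rw [← Real.rpow_mul (by positivity), one_div, inv_mul_cancel₀ hγ.ne', Real.rpow_one]
      _ ≤ (m : ℝ) ^ γ := Real.rpow_le_rpow (by positivity) h2 hγ.le
  have hmγ2 : (2 : ℝ) ≤ (m : ℝ) ^ γ := by
    have : (2 : ℝ) ≤ (((16 * k + 2 : ℕ) : ℝ)) := by
      have : (2 : ℕ) ≤ 16 * k + 2 := by omega
      exact_mod_cast this
    linarith
  have hm2ε : 2 / ε ≤ (m : ℝ) := by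
    have h1 : ⌈2 / ε⌉₊ ≤ m := by omega
    exact (Nat.le_ceil _).trans (by exact_mod_cast h1)
  have h1mε : 1 / (m : ℝ) ≤ ε / 2 := by
    have h1 : 1 / (m : ℝ) ≤ 1 / (2 / ε) := one_div_le_one_div_of_le (by positivity) hm2ε
    rw [one_div_div] at h1
    linarith
  have hm2s : 2 / (1 - s₀) ≤ (m : ℝ) := by
    have h1 : ⌈2 / (1 - s₀)⌉₊ ≤ m := by omega
    exact (Nat.le_ceil _).trans (by exact_mod_cast h1)
  have h1ms : 1 / (m : ℝ) ≤ (1 - s₀) / 2 := by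
    have hs' : 0 < 1 - s₀ := by linarith
    have h1 : 1 / (m : ℝ) ≤ 1 / (2 / (1 - s₀)) := one_div_le_one_div_of_le (by positivity) hm2s
    rw [one_div_div] at h1
    linarith
  -- `f(m) = ⌊m^γ⌋`: `16k ≤ f(m)`, `f(m) ≥ m^γ/2`
  have hfm_ge : (m : ℝ) ^ γ - 1 ≤ ((f m : ℕ) : ℝ) := (Nat.sub_one_lt_floor _).le
  have h16k : 16 * k ≤ f m := by
    apply Nat.le_floor
    have h' := hm16k
    push_cast at h' ⊢
    linarith
  have hfm2 : (m : ℝ) ^ γ / 2 ≤ ((f m : ℕ) : ℝ) := by linarith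
  -- Sherali–Adams fails `(c,s)` at degree `f(m)` on `m` variables
  have hSA : ¬ SAAchieves (n := m) P (f m) c s := HSA m hmn₁
  -- the restricted relaxation achieves `(c − 1/m, s)` on `m^H` variables
  have hgap : 1 / (m : ℝ) < c - s := by linarith
  have hAch : (L.restrict (Fin.castLEEmb hmH)).Achieves (c - 1 / m) s := by
    have h' := hL.restrict (Fin.castLEEmb hmH)
    intro I hI
    exact (h' I (hI.mono (by rw [hsdef]; linarith))).mono (by rw [hcdef]; linarith)
  -- the size bound: `R < 2^{N^{c₃}} ≤ m^{h f(m)}`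
  have hNc₃ : K₀ ≤ (N : ℝ) ^ c₃ := by
    have h1 : K₀ ^ (2 * (H : ℝ) / γ) ≤ N := (Nat.le_ceil _).trans (by exact_mod_cast hN2)
    have h2 : (K₀ ^ (2 * (H : ℝ) / γ)) ^ c₃ ≤ (N : ℝ) ^ c₃ :=
      Real.rpow_le_rpow (by positivity) h1 hc₃.le
    have h3 : (K₀ ^ (2 * (H : ℝ) / γ)) ^ c₃ = K₀ := by
      rw [← Real.rpow_mul hK₀.le, hc₃def]
      rw [show 2 * (H : ℝ) / γ * (γ / (2 * H)) = 1 by field_simp, Real.rpow_one]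
    linarith
  have hNγH : (N : ℝ) ^ (γ / H) = (N : ℝ) ^ c₃ * (N : ℝ) ^ c₃ := by
    rw [← Real.rpow_add' hNR0, hc₃def]
    · ring_nf
    · rw [hc₃def]; positivity
  have hyγ : y ^ γ = (N : ℝ) ^ (γ / H) := by
    rw [hydef, ← Real.rpow_mul hNR0]; ring_nf
  have hmγ : (N : ℝ) ^ (γ / H) / (2 : ℝ) ^ γ ≤ (m : ℝ) ^ γ := by
    rw [← hyγ, div_le_iff₀ (by positivity), ← Real.mul_rpow hm0.le (by norm_num)]
    exact Real.rpow_le_rpow hy0 (by linarith) hγ.le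
  have hkey : (2 : ℝ) ^ ((N : ℝ) ^ c₃) ≤ (m : ℝ) ^ (h * (f m : ℕ)) := by
    rw [Real.rpow_def_of_pos two_pos, Real.rpow_def_of_pos hm0, Real.exp_le_exp]
    have hlog2 : 0 < Real.log 2 := Real.log_pos one_lt_two
    have hlog2m : Real.log 2 ≤ Real.log m := Real.log_le_log two_pos (by linarith)
    have hNc0 : 0 ≤ (N : ℝ) ^ c₃ := Real.rpow_nonneg hNR0 _
    have h2γ : 0 < (2 : ℝ) ^ γ := by positivity
    have h1 : (N : ℝ) ^ c₃ ≤ h / (2 * (2 : ℝ) ^ γ) * ((N : ℝ) ^ c₃ * (N : ℝ) ^ c₃) := by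
      have : h / (2 * (2 : ℝ) ^ γ) * K₀ = 1 := by rw [hK₀def]; field_simp
      calc (N : ℝ) ^ c₃ = h / (2 * (2 : ℝ) ^ γ) * K₀ * (N : ℝ) ^ c₃ := by rw [this, one_mul]
        _ ≤ h / (2 * (2 : ℝ) ^ γ) * (N : ℝ) ^ c₃ * (N : ℝ) ^ c₃ := by
            apply mul_le_mul_of_nonneg_right _ hNc0
            exact mul_le_mul_of_nonneg_left hNc₃ (by positivity)
        _ = h / (2 * (2 : ℝ) ^ γ) * ((N : ℝ) ^ c₃ * (N : ℝ) ^ c₃) := by ring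
    have h2 : h / (2 * (2 : ℝ) ^ γ) * ((N : ℝ) ^ c₃ * (N : ℝ) ^ c₃) ≤ h * ((m : ℝ) ^ γ / 2) := by
      rw [← hNγH]
      have := mul_le_mul_of_nonneg_left hmγ hh.le
      calc h / (2 * (2 : ℝ) ^ γ) * (N : ℝ) ^ (γ / H)
          = h * ((N : ℝ) ^ (γ / H) / (2 : ℝ) ^ γ) / 2 := by field_simp
        _ ≤ h * (m : ℝ) ^ γ / 2 := by linarith
        _ = h * ((m : ℝ) ^ γ / 2) := by ring
    have h3 : h * ((m : ℝ) ^ γ / 2) ≤ h * ((f m : ℕ) : ℝ) := mul_le_mul_of_nonneg_left hfm2 hh.le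
    calc Real.log 2 * (N : ℝ) ^ c₃ ≤ Real.log 2 * (h * ((f m : ℕ) : ℝ)) :=
          mul_le_mul_of_nonneg_left (h1.trans (h2.trans h3)) hlog2.le
      _ ≤ Real.log m * (h * ((f m : ℕ) : ℝ)) :=
          mul_le_mul_of_nonneg_right hlog2m (by positivity)
  have hRle : (R : ℝ) ≤ (m : ℝ) ^ (h * (f m : ℕ)) := (hR.trans_le hkey).le
  exact T12 k P c s hc1 f m hmn₀ hgap h16k hSA R hRle _ hAch

/-- **Integrality-gap reading of `KothariMekaRaghavendra2017_lp_of_polyRoundSAGap` — PROVED:** under the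
same polynomial-round Sherali–Adams gap with `0 < s₀ < 1`, for every `ε > 0` there are `c₃ > 0`, `N₀`
such that no LP relaxation of Max-`𝒫_N` (`N ≥ N₀`) of size `< 2^{N^{c₃}}` has integrality gap
`< 1/s₀ − ε` (gap `< ρ` ⇒ `(ρ s, s)`-approximation, `LPRelaxation.GapLT.achieves`, with
`s = s₀ + ε'`, `ε' = min(ε,1) s₀²/4`).
[cite: KothariMekaRaghavendra2017, Cor. 1.5 (p. 4) and its proof (§7, p. 21)] -/
theorem KothariMekaRaghavendra2017_lpGap_of_polyRoundSAGap {k : ℕ} (P : Set ((Fin k → Bool) → Bool))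
    {s₀ : ℝ} (hs₀ : 0 < s₀) (hs₁ : s₀ < 1)
    (hSAgap : ∀ ε : ℝ, 0 < ε → ∃ γ : ℝ, 0 < γ ∧ ∃ n₀ : ℕ, ∀ n : ℕ, n₀ ≤ n →
      ¬ SAAchieves (n := n) P ⌊(n : ℝ) ^ γ⌋₊ (1 - ε) (s₀ + ε))
    {ε : ℝ} (hε : 0 < ε) :
    ∃ c₃ : ℝ, 0 < c₃ ∧ ∃ N₀ : ℕ, ∀ N : ℕ, N₀ ≤ N →
      ∀ R : ℕ, (R : ℝ) < (2 : ℝ) ^ ((N : ℝ) ^ c₃) →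
        ∀ L : LPRelaxation k N P R, ¬ L.GapLT (1 / s₀ - ε) := by
  set ε' : ℝ := min ε 1 * s₀ ^ 2 / 4 with hε'
  have hm0 : 0 < min ε 1 := lt_min hε one_pos
  have hm1 : min ε 1 ≤ 1 := min_le_right _ _
  have hmε : min ε 1 ≤ ε := min_le_left _ _
  have hε'0 : 0 < ε' := by rw [hε']; positivity
  have hs₀2 : s₀ ^ 2 ≤ s₀ := by nlinarith
  have hε's : ε' ≤ min ε 1 * s₀ / 4 := by
    rw [hε']
    have := mul_le_mul_of_nonneg_left hs₀2 hm0.le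
    linarith
  have hε'1 : ε' ≤ 1 / 4 := by nlinarith
  obtain ⟨c₃, hc₃, N₀, hN₀⟩ := KothariMekaRaghavendra2017_lp_of_polyRoundSAGap P hs₁ hSAgap hε'0
  refine ⟨c₃, hc₃, N₀, fun N hN R hR L hgap => hN₀ N hN R hR L ?_⟩
  refine hgap.achieves (by positivity) ?_ (by linarith)
  -- `(1/s₀ − ε)(s₀ + ε') ≤ 1 − ε'`
  have hexp : (1 / s₀ - ε) * (s₀ + ε') = 1 + ε' / s₀ - ε * s₀ - ε * ε' := by
    field_simp
    ring
  have h1 : ε' / s₀ = min ε 1 * s₀ / 4 := by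
    rw [hε']
    field_simp
  rw [hexp, h1]
  have h4 : 0 ≤ ε * ε' := by positivity
  have h5 : min ε 1 * s₀ ≤ ε * s₀ := mul_le_mul_of_nonneg_right hmε hs₀.le
  linarith

/-- `R < 2^{N^{c/2}}` forces `R + 2 < 2^{N^{c}}` once `N^{c/2} ≥ 2` (`N ≥ 4^{1/c}`): the size padding of
the `+2`-inequality reductions. [folklore] -/
private theorem two_rpow_pad {c : ℝ} (hc : 0 < c) :
    ∃ N₁ : ℕ, ∀ N : ℕ, N₁ ≤ N → ∀ R : ℕ, (R : ℝ) < (2 : ℝ) ^ ((N : ℝ) ^ (c / 2)) →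
      (R : ℝ) + 2 < (2 : ℝ) ^ ((N : ℝ) ^ c) := by
  refine ⟨⌈(4 : ℝ) ^ (1 / c)⌉₊, fun N hN R hR => ?_⟩
  have hN0 : (0 : ℝ) ≤ N := Nat.cast_nonneg N
  set t : ℝ := (N : ℝ) ^ (c / 2) with ht
  -- `t ≥ 2`
  have h4N : (4 : ℝ) ^ (1 / c) ≤ N := (Nat.le_ceil _).trans (by exact_mod_cast hN)
  have ht2 : (2 : ℝ) ≤ t := by
    have h1 : ((4 : ℝ) ^ (1 / c)) ^ (c / 2) ≤ t := Real.rpow_le_rpow (by positivity) h4N (by positivity)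
    have h2 : ((4 : ℝ) ^ (1 / c)) ^ (c / 2) = 2 := by
      rw [← Real.rpow_mul (by norm_num), show 1 / c * (c / 2) = (1 / 2 : ℝ) by field_simp]
      rw [show (4 : ℝ) = 2 ^ (2 : ℝ) by norm_num, ← Real.rpow_mul (by norm_num)]
      norm_num
    linarith
  -- `N^c = t·t`
  have hNc : (N : ℝ) ^ c = t * t := by
    rw [ht, ← Real.rpow_add' hN0] <;> ring_nf
    exact hc.ne'
  have h2t : (2 : ℝ) ≤ (2 : ℝ) ^ t := by
    calc (2 : ℝ) = (2 : ℝ) ^ (1 : ℝ) := (Real.rpow_one 2).symm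
      _ ≤ (2 : ℝ) ^ t := Real.rpow_le_rpow_of_exponent_le one_le_two (by linarith)
  have htt : 2 * t ≤ t * t := by nlinarith
  calc (R : ℝ) + 2 < (2 : ℝ) ^ t + 2 := by linarith
    _ ≤ (2 : ℝ) ^ t * (2 : ℝ) ^ t := by nlinarith
    _ = (2 : ℝ) ^ (2 * t) := by rw [two_mul, Real.rpow_add two_pos]
    _ ≤ (2 : ℝ) ^ (t * t) := Real.rpow_le_rpow_of_exponent_le one_le_two htt
    _ = (2 : ℝ) ^ ((N : ℝ) ^ c) := by rw [hNc]

/-- **MAX-CUT, `(c,s)` form of KMR Cor. 1.5 — PROVED:** for every `ε > 0` there are `c₃ > 0` and `N₀`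
such that for all `N ≥ N₀` no LP relaxation of MAX-CUT on `N` vertices of size `R < 2^{N^{c₃}}`
achieves a `(1 − ε, 1/2 + ε)`-approximation (Thm 1.2 × the Charikar–Makarychev–Makarychev
Sherali–Adams gap `CharikarMakarychevMakarychev2009_maxCutSA_holds`; the gap form `< 2 − ε` is the
tree's `KothariMekaRaghavendra2017_cor15_maxCut_holds`).
[cite: KothariMekaRaghavendra2017, Thm 1.2, Thm 1.3, Cor. 1.5 (p. 3–4), proof of Cor. 1.5 (§7, p. 21)]
[cite: CharikarMakarychevMakarychev2009, Thm 5.3] -/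
theorem KothariMekaRaghavendra2017_maxCut_lp {ε : ℝ} (hε : 0 < ε) :
    ∃ c₃ : ℝ, 0 < c₃ ∧ ∃ N₀ : ℕ, ∀ N : ℕ, N₀ ≤ N →
      ∀ R : ℕ, (R : ℝ) < (2 : ℝ) ^ ((N : ℝ) ^ c₃) →
        ∀ L : LPRelaxation 2 N maxCutPreds R, ¬ L.Achieves (1 - ε) (1 / 2 + ε) :=
  KothariMekaRaghavendra2017_lp_of_polyRoundSAGap maxCutPreds (by norm_num)
    (fun δ hδ => CharikarMakarychevMakarychev2009_maxCutSA_holds δ hδ) hε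

/-- **Max-2-CSP (any binary family containing `≠`), weakly-exponential regime — PROVED:** for every
`ε > 0` there are `c > 0`, `N₀` such that for `N ≥ N₀` no LP relaxation of size `< 2^{N^{c}}` achieves
`(1 − ε, 1/2 + ε)` (the Cor. 6.4 reduction `LPRelaxation.maxCut_of_incl` on the KMR MAX-CUT bound).
[cite: BraunPokuttaZink2015, Cor. 6.4 (LP clause) with Prop. 4.2 (reduction; printed regime `n^{Ω(log n/loglog n)}`)]
[cite: KothariMekaRaghavendra2017, Cor. 1.5 (MAX-CUT clause, p. 4)] -/
theorem binaryCsp_subexp_lp_of_neq {P₂ : Set ((Fin 2 → Bool) → Bool)} (hP : neqPred ∈ P₂) {ε : ℝ}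
    (hε : 0 < ε) :
    ∃ c : ℝ, 0 < c ∧ ∃ N₀ : ℕ, ∀ N : ℕ, N₀ ≤ N →
      ∀ R : ℕ, (R : ℝ) < (2 : ℝ) ^ ((N : ℝ) ^ c) →
        ∀ L : LPRelaxation 2 N P₂ R, ¬ L.Achieves (1 - ε) (1 / 2 + ε) := by
  obtain ⟨c₃, hc₃, N₀, H⟩ := KothariMekaRaghavendra2017_maxCut_lp hε
  obtain ⟨N₁, hN₁⟩ := two_rpow_pad hc₃
  refine ⟨c₃ / 2, by positivity, max N₀ N₁, fun N hN R hR L hL => ?_⟩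
  obtain ⟨L', hL'⟩ := L.maxCut_of_incl hP hL
  refine H N (le_trans (le_max_left _ _) hN) (R + 2) ?_ L' hL'
  push_cast
  exact hN₁ N (le_trans (le_max_right _ _) hN) R hR

/-- **Max-2-CSP with `≠`, gap form — PROVED:** no LP relaxation of size `< 2^{N^{c}}` has integrality gap
`< 2 − ε` (`N ≥ N₀`). [cite: BraunPokuttaZink2015, Cor. 6.4 (LP clause) with Prop. 4.2]
[cite: KothariMekaRaghavendra2017, Cor. 1.5 (MAX-CUT clause, p. 4)] -/
theorem binaryCsp_subexp_lpGap_of_neq {P₂ : Set ((Fin 2 → Bool) → Bool)} (hP : neqPred ∈ P₂) {ε : ℝ}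
    (hε : 0 < ε) :
    ∃ c : ℝ, 0 < c ∧ ∃ N₀ : ℕ, ∀ N : ℕ, N₀ ≤ N →
      ∀ R : ℕ, (R : ℝ) < (2 : ℝ) ^ ((N : ℝ) ^ c) →
        ∀ L : LPRelaxation 2 N P₂ R, ¬ L.GapLT (2 - ε) := by
  -- margin `ε' = min(ε,1)/8`: `(2 − ε)(1/2 + ε') ≤ 1 − ε'`
  set ε' : ℝ := min ε 1 / 8 with hε'
  have hm0 : 0 < min ε 1 := lt_min hε one_pos
  have hε'0 : 0 < ε' := by rw [hε']; positivity
  have hε'ε : ε' ≤ ε / 8 := by rw [hε']; linarith [min_le_left ε 1]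
  have hε'1 : ε' ≤ 1 / 8 := by rw [hε']; linarith [min_le_right ε 1]
  obtain ⟨c, hc, N₀, H⟩ := binaryCsp_subexp_lp_of_neq hP hε'0
  refine ⟨c, hc, N₀, fun N hN R hR L hgap => H N hN R hR L ?_⟩
  refine hgap.achieves (by positivity) ?_ (by linarith)
  nlinarith

/-- **Max-2-SAT-type families (containing the clauses `y_0 ∨ y_1`, `ȳ_0 ∨ ȳ_1`), weakly-exponential
regime — PROVED:** for every `ε > 0` there are `c > 0`, `N₀` such that for `N ≥ N₀` no LP relaxation of
size `< 2^{N^{c}}` achieves `(1 − ε, 3/4 + ε)` (the Cor. 6.6 reduction `LPRelaxation.maxCut_of_sat` on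
the KMR MAX-CUT bound at `(1 − 2ε, 1/2 + 2ε)`).
[cite: BraunPokuttaZink2015, Cor. 6.6 (LP clause) with Prop. 4.2 (reduction; printed regime `n^{Ω(log n/loglog n)}`)]
[cite: KothariMekaRaghavendra2017, Cor. 1.5 (MAX-CUT clause, p. 4)] -/
theorem binaryCsp_subexp_lp_of_clauses {P₂ : Set ((Fin 2 → Bool) → Bool)}
    (h0 : clausePred (fun _ => false) ∈ P₂) (h1 : clausePred (fun _ => true) ∈ P₂) {ε : ℝ}
    (hε : 0 < ε) :
    ∃ c : ℝ, 0 < c ∧ ∃ N₀ : ℕ, ∀ N : ℕ, N₀ ≤ N →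
      ∀ R : ℕ, (R : ℝ) < (2 : ℝ) ^ ((N : ℝ) ^ c) →
        ∀ L : LPRelaxation 2 N P₂ R, ¬ L.Achieves (1 - ε) (3 / 4 + ε) := by
  obtain ⟨c₃, hc₃, N₀, H⟩ := KothariMekaRaghavendra2017_maxCut_lp (ε := 2 * ε) (by positivity)
  obtain ⟨N₁, hN₁⟩ := two_rpow_pad hc₃
  refine ⟨c₃ / 2, by positivity, max N₀ N₁, fun N hN R hR L hL => ?_⟩
  have e1 : (1 - ε : ℝ) = (1 + (1 - 2 * ε)) / 2 := by ring
  have e2 : (3 / 4 + ε : ℝ) = (1 + (1 / 2 + 2 * ε)) / 2 := by ring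
  have hL' : L.Achieves ((1 + (1 - 2 * ε)) / 2) ((1 + (1 / 2 + 2 * ε)) / 2) := by
    rw [← e1, ← e2]; exact hL
  obtain ⟨L', hL''⟩ := L.maxCut_of_sat h0 h1 hL'
  refine H N (le_trans (le_max_left _ _) hN) (R + 2) ?_ L' hL''
  push_cast
  exact hN₁ N (le_trans (le_max_right _ _) hN) R hR

/-- **Max-2-SAT with the printed constants `(1 − ε, 3/4 + ε)`, weakly-exponential regime — PROVED:**
no LP relaxation of Max-2-SAT on `N ≥ N₀` variables of size `< 2^{N^{c}}` achieves `(1 − ε, 3/4 + ε)`.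
[cite: BraunPokuttaZink2015, Cor. 6.6 (LP clause) with Prop. 4.2] [cite: KothariMekaRaghavendra2017, Cor. 1.5 (MAX-CUT clause, p. 4)] -/
theorem maxTwoSat_subexp_lp {ε : ℝ} (hε : 0 < ε) :
    ∃ c : ℝ, 0 < c ∧ ∃ N₀ : ℕ, ∀ N : ℕ, N₀ ≤ N →
      ∀ R : ℕ, (R : ℝ) < (2 : ℝ) ^ ((N : ℝ) ^ c) →
        ∀ L : LPRelaxation 2 N (maxKSatPreds 2) R, ¬ L.Achieves (1 - ε) (3 / 4 + ε) :=
  binaryCsp_subexp_lp_of_clauses (clausePred_mem _) (clausePred_mem _) hε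

/-- **Max-2-SAT, gap form — PROVED:** for every `ε > 0` there are `c > 0`, `N₀` with: no LP relaxation of
Max-2-SAT on `N ≥ N₀` variables of size `< 2^{N^{c}}` has integrality gap `< 4/3 − ε` (margin
`ε' = min(ε,1)/4`: `(4/3 − ε)(3/4 + ε') ≤ 1 − ε'`).
[cite: BraunPokuttaZink2015, Cor. 6.6 (LP clause: "inapproximability factor 3/4 + Θ(ε)") with Prop. 4.2]
[cite: KothariMekaRaghavendra2017, Cor. 1.5 (MAX-CUT clause, p. 4)] -/
theorem maxTwoSat_subexp_lpGap {ε : ℝ} (hε : 0 < ε) :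
    ∃ c : ℝ, 0 < c ∧ ∃ N₀ : ℕ, ∀ N : ℕ, N₀ ≤ N →
      ∀ R : ℕ, (R : ℝ) < (2 : ℝ) ^ ((N : ℝ) ^ c) →
        ∀ L : LPRelaxation 2 N (maxKSatPreds 2) R, ¬ L.GapLT (4 / 3 - ε) := by
  set ε' : ℝ := min ε 1 / 4 with hε'
  have hm0 : 0 < min ε 1 := lt_min hε one_pos
  have hε'0 : 0 < ε' := by rw [hε']; positivity
  have hε'ε : ε' ≤ ε / 4 := by rw [hε']; linarith [min_le_left ε 1]
  have hε'1 : ε' ≤ 1 / 4 := by rw [hε']; linarith [min_le_right ε 1]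
  obtain ⟨c, hc, N₀, H⟩ := maxTwoSat_subexp_lp hε'0
  refine ⟨c, hc, N₀, fun N hN R hR L hgap => H N hN R hR L ?_⟩
  refine hgap.achieves (by positivity) ?_ (by linarith)
  nlinarith

/-- **MaxDICUT-type families (containing `¬y_0 ∧ y_1`), weakly-exponential regime — PROVED:** for every
`ε > 0` there are `c > 0`, `N₀` such that for `N ≥ N₀` no LP relaxation of size `< 2^{N^{c}}` achieves
`(1/2 − ε, 1/4 + ε)` (the Cor. 6.8 reduction `LPRelaxation.maxCut_of_dicut` on the KMR MAX-CUT bound at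
`(1 − 2ε, 1/2 + 2ε)`).
[cite: BraunPokuttaZink2015, Cor. 6.8 and Cor. 6.4 (LP clauses) with Prop. 4.2 (reduction; printed regime `n^{Ω(log n/loglog n)}`)]
[cite: KothariMekaRaghavendra2017, Cor. 1.5 (MAX-CUT clause, p. 4)] -/
theorem binaryCsp_subexp_lp_of_dicut {P₂ : Set ((Fin 2 → Bool) → Bool)} (hP : dicutPred ∈ P₂) {ε : ℝ}
    (hε : 0 < ε) :
    ∃ c : ℝ, 0 < c ∧ ∃ N₀ : ℕ, ∀ N : ℕ, N₀ ≤ N →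
      ∀ R : ℕ, (R : ℝ) < (2 : ℝ) ^ ((N : ℝ) ^ c) →
        ∀ L : LPRelaxation 2 N P₂ R, ¬ L.Achieves (1 / 2 - ε) (1 / 4 + ε) := by
  obtain ⟨c₃, hc₃, N₀, H⟩ := KothariMekaRaghavendra2017_maxCut_lp (ε := 2 * ε) (by positivity)
  obtain ⟨N₁, hN₁⟩ := two_rpow_pad hc₃
  refine ⟨c₃ / 2, by positivity, max N₀ N₁, fun N hN R hR L hL => ?_⟩
  have e1 : (1 / 2 - ε : ℝ) = (1 - 2 * ε) / 2 := by ring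
  have e2 : (1 / 4 + ε : ℝ) = (1 / 2 + 2 * ε) / 2 := by ring
  have hL' : L.Achieves ((1 - 2 * ε) / 2) ((1 / 2 + 2 * ε) / 2) := by
    rw [← e1, ← e2]; exact hL
  obtain ⟨L', hL''⟩ := L.maxCut_of_dicut hP hL'
  refine H N (le_trans (le_max_left _ _) hN) (R + 2) ?_ L' hL''
  push_cast
  exact hN₁ N (le_trans (le_max_right _ _) hN) R hR

/-- **MaxDICUT with the printed constants `(1/2 − ε, 1/4 + ε)`, weakly-exponential regime — PROVED.**
[cite: BraunPokuttaZink2015, Cor. 6.8 (LP clause) with Prop. 4.2] [cite: KothariMekaRaghavendra2017, Cor. 1.5 (MAX-CUT clause, p. 4)] -/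
theorem maxDicut_subexp_lp {ε : ℝ} (hε : 0 < ε) :
    ∃ c : ℝ, 0 < c ∧ ∃ N₀ : ℕ, ∀ N : ℕ, N₀ ≤ N →
      ∀ R : ℕ, (R : ℝ) < (2 : ℝ) ^ ((N : ℝ) ^ c) →
        ∀ L : LPRelaxation 2 N dicutPreds R, ¬ L.Achieves (1 / 2 - ε) (1 / 4 + ε) :=
  binaryCsp_subexp_lp_of_dicut (P₂ := dicutPreds) (Set.mem_singleton _) hε

/-- **Max-2-CONJSAT with the printed constants `(1/2 − ε, 1/4 + ε)`, weakly-exponential regime — PROVED.**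
[cite: BraunPokuttaZink2015, Cor. 6.4 (Max-2-CONJSAT, LP clause) with Prop. 4.2] [cite: KothariMekaRaghavendra2017, Cor. 1.5 (MAX-CUT clause, p. 4)] -/
theorem maxTwoConjSat_subexp_lp {ε : ℝ} (hε : 0 < ε) :
    ∃ c : ℝ, 0 < c ∧ ∃ N₀ : ℕ, ∀ N : ℕ, N₀ ≤ N →
      ∀ R : ℕ, (R : ℝ) < (2 : ℝ) ^ ((N : ℝ) ^ c) →
        ∀ L : LPRelaxation 2 N (literalClosure andTwo) R, ¬ L.Achieves (1 / 2 - ε) (1 / 4 + ε) :=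
  binaryCsp_subexp_lp_of_dicut dicutPred_mem_literalClosure hε

/-- **MaxDICUT, gap form — PROVED:** for every `ε > 0` there are `c > 0`, `N₀` with: no LP relaxation of
MaxDICUT on `N ≥ N₀` variables of size `< 2^{N^{c}}` has integrality gap `< 2 − ε` (margin
`ε' = min(ε,1)/16`: `(2 − ε)(1/4 + ε') ≤ 1/2 − ε'`).
[cite: BraunPokuttaZink2015, Cor. 6.8 (LP clause: "inapproximability factor 1/2 + Θ(ε)") with Prop. 4.2]
[cite: KothariMekaRaghavendra2017, Cor. 1.5 (MAX-CUT clause, p. 4)] -/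
theorem maxDicut_subexp_lpGap {ε : ℝ} (hε : 0 < ε) :
    ∃ c : ℝ, 0 < c ∧ ∃ N₀ : ℕ, ∀ N : ℕ, N₀ ≤ N →
      ∀ R : ℕ, (R : ℝ) < (2 : ℝ) ^ ((N : ℝ) ^ c) →
        ∀ L : LPRelaxation 2 N dicutPreds R, ¬ L.GapLT (2 - ε) := by
  set ε' : ℝ := min ε 1 / 16 with hε'
  have hm0 : 0 < min ε 1 := lt_min hε one_pos
  have hε'0 : 0 < ε' := by rw [hε']; positivity
  have hε'ε : ε' ≤ ε / 16 := by rw [hε']; linarith [min_le_left ε 1]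
  have hε'1 : ε' ≤ 1 / 16 := by rw [hε']; linarith [min_le_right ε 1]
  obtain ⟨c, hc, N₀, H⟩ := maxDicut_subexp_lp hε'0
  refine ⟨c, hc, N₀, fun N hN R hR L hgap => H N hN R hR L ?_⟩
  refine hgap.achieves (by positivity) ?_ (by linarith)
  nlinarith

end WeaklyExponential

end Literature.Combinatorics.Optimization

end
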